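import Mathlib
import Summits.Ventures.PercRepro2.ZMeanProof
import Summits.Ventures.PercRepro2.PendantRoot

/-!
# The mean field `X̂` is a Rao–Blackwell sum along the cluster of `a₃`
(blind cell PercRepro2, night-1 g7; NIGHT1-G7.md §2)

`X̂ = Σ_W P(C(a₃) = W) · termW(W)` (ZMean.lean) is built from residual-graph probabilities in
`G ∖ W`.  By the domain Markov property each summand is a RAO–BLACKWELL term of the joint masses
`x_W(X) = P({C(a₃) = W} ∩ Q ∩ X)`, `z_W = P({C(a₃) = W} ∩ Q)`, `Q = {a₁ ↮ a₂}` (`rbTerm`):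

* PD-type `W` (`a₁, a₂ ∉ W`): `[x_W(oL) x_W(bH) + x_W(oH) x_W(bL)] / z_W` — the conditional
  cross products `μ(oL | W) μ(bH | W) + μ(oH | W) μ(bL | W)` weighted by `μ(W)`;
* T-type `W` (`a₂ ∈ W ∌ a₁`, so `C(a₃) = C₂`): `x_W(oL ∧ bH) − x_W(oL) x_W(bL) / z_W` — the exact
  cross joint minus the conditional same-side product (mirror for T′-type);
* `a₁, a₂ ∈ W`: `0`.

`Xhat_eq_rb : X̂ = Σ_W rbTerm W` (`prob_cl_mul_termW` termwise).  Hence the mean-field row (HMF)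
and the (HMF) leaf coefficient `κ` (HMFLeafRB.lean) are statements about the Rao–Blackwell
covariances of row 2′RB along the third cluster: with `ν(W) = z_W / Z`,
`Σ_{PD} [x(oL)x(bH) + x(oH)x(bL)]/z = Z · E_ν[1_{PD} (ôL b̂H + ôH b̂L)]`.
-/

namespace Summit.Ventures.PercRepro2

open UnionCluster CovForm PendantRoot

namespace XhatRB

variable {V : Type*} {E : Type*} [Fintype E] [DecidableEq E] [Fintype V] [DecidableEq V]
  {R : Type*} [Field R] [LinearOrder R] [IsStrictOrderedRing R]

variable (p : E → R) (ends : E → Sym2 V) (o a₁ a₂ a₃ b : V)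

/-- `{C(a₃) = W} ∩ Q`. -/
def clQ (W : Finset V) : Set (Config E) :=
  clusterEvent ends a₃ (↑W : Set V) ∩ avoidAll ends a₂ {a₁}

/-- **The Rao–Blackwell term of the cluster `W`** (see the module docstring). -/
noncomputable def rbTerm (W : Finset V) : R :=
  if a₁ ∈ W then
    (if a₂ ∈ W then 0 else
      prob p (clQ ends a₁ a₂ a₃ W ∩ (connEvent ends a₂ o ∩ connEvent ends a₁ b)) -
        prob p (clQ ends a₁ a₂ a₃ W ∩ connEvent ends a₂ o) *
          prob p (clQ ends a₁ a₂ a₃ W ∩ connEvent ends a₂ b) / prob p (clQ ends a₁ a₂ a₃ W))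
  else
    (if a₂ ∈ W then
      prob p (clQ ends a₁ a₂ a₃ W ∩ (connEvent ends a₁ o ∩ connEvent ends a₂ b)) -
        prob p (clQ ends a₁ a₂ a₃ W ∩ connEvent ends a₁ o) *
          prob p (clQ ends a₁ a₂ a₃ W ∩ connEvent ends a₁ b) / prob p (clQ ends a₁ a₂ a₃ W)
    else
      (prob p (clQ ends a₁ a₂ a₃ W ∩ connEvent ends a₁ o) *
            prob p (clQ ends a₁ a₂ a₃ W ∩ connEvent ends a₂ b) +
          prob p (clQ ends a₁ a₂ a₃ W ∩ connEvent ends a₂ o) *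
            prob p (clQ ends a₁ a₂ a₃ W ∩ connEvent ends a₁ b)) / prob p (clQ ends a₁ a₂ a₃ W))

section Tools

variable {p ends}

omit [Fintype V] [DecidableEq V] [LinearOrder R] [IsStrictOrderedRing R] in
/-- Domain Markov: an event determined by the edges outside `W` factors off `{C(a₃) = W}`. -/
lemma prob_cl_inter_of_dependsOn {W : Finset V} {X : Set (Config E)}
    (hX : DependsOn (· ∈ X) (touches ends ↑W)ᶜ) :
    prob p (clusterEvent ends a₃ (↑W : Set V) ∩ X) =
      prob p (clusterEvent ends a₃ (↑W : Set V)) * prob p X :=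
  prob_clusterEvent_inter_eq_mul p ends a₃ (↑W : Set V) hX disjoint_compl_right

omit [Fintype E] [DecidableEq E] in
/-- `delQ` is determined by the edges outside `W`. -/
lemma dependsOn_delQ (W : Finset V) :
    DependsOn (· ∈ delQ ends W a₁ a₂) (touches ends ↑W)ᶜ :=
  dependsOn_compl (dependsOn_connDelEvent ends W a₁ a₂)

omit [Fintype E] [DecidableEq E] in
/-- `delQ ∩ connDel` is determined by the edges outside `W`. -/
lemma dependsOn_delQ_inter (W : Finset V) (x v : V) :
    DependsOn (· ∈ delQ ends W a₁ a₂ ∩ connDelEvent ends W x v) (touches ends ↑W)ᶜ := by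
  have h := dependsOn_inter (dependsOn_delQ (ends := ends) a₁ a₂ W) (dependsOn_connDelEvent ends W x v)
  simpa only [Set.union_self] using h

omit [Fintype E] [DecidableEq E] in
/-- Two events agreeing on `cl` have intersections agreeing on `cl`. -/
lemma cl_inter_inter_congr {cl A A' B B' : Set (Config E)} (hA : cl ∩ A = cl ∩ A')
    (hB : cl ∩ B = cl ∩ B') : cl ∩ (A ∩ B) = cl ∩ (A' ∩ B') := by
  ext ω
  constructor
  · rintro ⟨hc, ha, hb⟩
    have ha' : ω ∈ cl ∩ A' := hA ▸ ⟨hc, ha⟩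
    have hb' : ω ∈ cl ∩ B' := hB ▸ ⟨hc, hb⟩
    exact ⟨hc, ha'.2, hb'.2⟩
  · rintro ⟨hc, ha, hb⟩
    have ha' : ω ∈ cl ∩ A := hA.symm ▸ ⟨hc, ha⟩
    have hb' : ω ∈ cl ∩ B := hB.symm ▸ ⟨hc, hb⟩
    exact ⟨hc, ha'.2, hb'.2⟩

omit [Fintype E] [DecidableEq E] in
/-- On a PD-type cluster `Q` is the residual disconnection. -/
lemma cl_inter_Q_eq_delQ {W : Finset V} (h1 : a₁ ∉ W) :
    clusterEvent ends a₃ (↑W : Set V) ∩ avoidAll ends a₂ {a₁} =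
      clusterEvent ends a₃ (↑W : Set V) ∩ delQ ends W a₁ a₂ := by
  rw [avoidAll_eq_compl, cl_inter_compl_conn_eq_del ends a₃ W (by simpa using h1)]
  rfl

/-- `P(clQ ∩ {x ↔ v}) = P(C(a₃) = W) · delShareMass` on a PD-type cluster, for a root `x ∉ W`. -/
lemma prob_clQ_inter_conn {W : Finset V} (h1 : a₁ ∉ W) (hp : IsProbVec p) {x : V} (hx : x ∉ W)
    (v : V) :
    prob p (clQ ends a₁ a₂ a₃ W ∩ connEvent ends x v) =
      prob p (clusterEvent ends a₃ (↑W : Set V)) * delShareMass p ends W a₁ a₂ x v := by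
  unfold clQ delShareMass
  by_cases hv : v ∈ W
  · rw [if_pos hv, mul_zero]
    refine prob_eq_zero_of_subset_empty p hp (B := clusterEvent ends a₃ (↑W : Set V) ∩ connEvent ends x v)
      (fun ω hω => ⟨hω.1.1, hω.2⟩) (cl_inter_conn_eq_empty ends a₃ (↑W : Set V) (by simpa using hx) (by simpa using hv))
  · rw [if_neg hv, Set.inter_assoc,
      cl_inter_inter_congr (cl_inter_Q_eq_delQ a₁ a₂ a₃ h1) (cl_inter_conn_eq_del ends a₃ W (w := v) hx),
      prob_cl_inter_of_dependsOn a₃ (dependsOn_delQ_inter a₁ a₂ W x v)]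

omit [LinearOrder R] [IsStrictOrderedRing R] in
/-- `P(clQ) = P(C(a₃) = W) · P(delQ)` on a PD-type cluster. -/
lemma prob_clQ {W : Finset V} (h1 : a₁ ∉ W) :
    prob p (clQ ends a₁ a₂ a₃ W) =
      prob p (clusterEvent ends a₃ (↑W : Set V)) * prob p (delQ ends W a₁ a₂) := by
  unfold clQ
  rw [cl_inter_Q_eq_delQ a₁ a₂ a₃ h1, prob_cl_inter_of_dependsOn a₃ (dependsOn_delQ a₁ a₂ W)]

/-- `P(cl ∩ {x ↔ v}) = P(cl) · delConnProb` for `x ∉ W`. -/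
lemma prob_cl_inter_conn {W : Finset V} (hp : IsProbVec p) {x : V} (hx : x ∉ W) (v : V) :
    prob p (clusterEvent ends a₃ (↑W : Set V) ∩ connEvent ends x v) =
      prob p (clusterEvent ends a₃ (↑W : Set V)) * delConnProb p ends W x v := by
  unfold delConnProb
  by_cases hv : v ∈ W
  · rw [if_pos hv, mul_zero]
    exact prob_eq_zero_of_subset_empty p hp (B := clusterEvent ends a₃ (↑W : Set V) ∩ connEvent ends x v)
      (fun ω hω => hω) (cl_inter_conn_eq_empty ends a₃ (↑W : Set V) (by simpa using hx) (by simpa using hv))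
  · rw [if_neg hv, cl_inter_conn_eq_del ends a₃ W (w := v) hx,
      prob_cl_inter_of_dependsOn a₃ (dependsOn_connDelEvent ends W x v)]

end Tools

section Cases

variable {p}

/-- **PD-type clusters**: `P(C(a₃) = W) · termPD = rbTerm`. -/
lemma pd_case (hp : IsProbVec p) {W : Finset V} (h1 : a₁ ∉ W) (h2 : a₂ ∉ W) :
    prob p (clusterEvent ends a₃ (↑W : Set V)) * termPD p ends W o a₁ a₂ b =
      (prob p (clQ ends a₁ a₂ a₃ W ∩ connEvent ends a₁ o) *
            prob p (clQ ends a₁ a₂ a₃ W ∩ connEvent ends a₂ b) +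
          prob p (clQ ends a₁ a₂ a₃ W ∩ connEvent ends a₂ o) *
            prob p (clQ ends a₁ a₂ a₃ W ∩ connEvent ends a₁ b)) / prob p (clQ ends a₁ a₂ a₃ W) := by
  rw [prob_clQ_inter_conn a₁ a₂ a₃ h1 hp h1 o, prob_clQ_inter_conn a₁ a₂ a₃ h1 hp h2 b,
    prob_clQ_inter_conn a₁ a₂ a₃ h1 hp h2 o, prob_clQ_inter_conn a₁ a₂ a₃ h1 hp h1 b,
    prob_clQ a₁ a₂ a₃ h1]
  unfold termPD
  by_cases hd : prob p (delQ ends W a₁ a₂) = 0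
  · simp [hd]
  · by_cases hc : prob p (clusterEvent ends a₃ (↑W : Set V)) = 0
    · simp [hc]
    · field_simp

/-- **T-type clusters** (free root `x ∉ W`, the other root `y ∈ W`, `cl ⊆ Q`):
`P(cl) · termT W o x b = P(cl ∩ Q ∩ {x ↔ o} ∩ {y ↔ b}) − P(cl ∩ Q ∩ {x ↔ o}) P(cl ∩ Q ∩ {x ↔ b}) / P(cl ∩ Q)`. -/
lemma t_case (hp : IsProbVec p) {W : Finset V} {x y : V} (hx : x ∉ W) (hy : y ∈ W)
    {Q' : Set (Config E)} (hQ : clusterEvent ends a₃ (↑W : Set V) ∩ Q' = clusterEvent ends a₃ (↑W : Set V)) :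
    prob p (clusterEvent ends a₃ (↑W : Set V)) * termT p ends W o x b =
      prob p (clusterEvent ends a₃ (↑W : Set V) ∩ Q' ∩ (connEvent ends x o ∩ connEvent ends y b)) -
        prob p (clusterEvent ends a₃ (↑W : Set V) ∩ Q' ∩ connEvent ends x o) *
          prob p (clusterEvent ends a₃ (↑W : Set V) ∩ Q' ∩ connEvent ends x b) /
          prob p (clusterEvent ends a₃ (↑W : Set V) ∩ Q') := by
  rw [hQ]
  set cl := clusterEvent ends a₃ (↑W : Set V) with hcl
  rw [prob_cl_inter_conn a₃ hp hx o, prob_cl_inter_conn a₃ hp hx b]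
  unfold termT
  by_cases ho : o ∈ W
  · have e0 : prob p (cl ∩ (connEvent ends x o ∩ connEvent ends y b)) = 0 :=
      prob_eq_zero_of_subset_empty p hp (B := cl ∩ connEvent ends x o) (fun ω hω => ⟨hω.1, hω.2.1⟩)
        (cl_inter_conn_eq_empty ends a₃ (↑W : Set V) (by simpa using hx) (by simpa using ho))
    rw [e0]
    simp [delConnProb, ho]
  · by_cases hb : b ∈ W
    · have e1 : cl ∩ (connEvent ends x o ∩ connEvent ends y b) = cl ∩ connEvent ends x o := by
        ext ω
        constructor
        · rintro ⟨hc, hxo, _⟩; exact ⟨hc, hxo⟩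
        · rintro ⟨hc, hxo⟩
          have : ω ∈ cl ∩ connEvent ends y b := by
            rw [hcl, cl_inter_conn_of_mem_mem ends a₃ (↑W : Set V) (by simpa using hy) (by simpa using hb)]
            exact hc
          exact ⟨hc, hxo, this.2⟩
      rw [e1, prob_cl_inter_conn a₃ hp hx o]
      simp only [delConnProb, hb, if_true, if_false, ho, mul_zero, zero_div, sub_zero, mul_one, hcl]
    · have e2 : prob p (cl ∩ (connEvent ends x o ∩ connEvent ends y b)) = 0 :=
        prob_eq_zero_of_subset_empty p hp (B := cl ∩ connEvent ends y b) (fun ω hω => ⟨hω.1, hω.2.2⟩)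
          (cl_inter_conn_eq_empty' ends a₃ (↑W : Set V) (by simpa using hy) (by simpa using hb))
      rw [e2]
      simp only [delConnProb, hb, if_false, ho, zero_sub, mul_neg]
      by_cases hc : prob p cl = 0
      · simp [hc]
      · field_simp
        ring

omit [Fintype E] [DecidableEq E] [Fintype V] [DecidableEq V] in
/-- On a T-type cluster (`a₁ ∉ W`, `a₂ ∈ W`) the event `Q` is automatic. -/
lemma cl_inter_Q_of_T {W : Finset V} (h1 : a₁ ∉ W) (h2 : a₂ ∈ W) :
    clusterEvent ends a₃ (↑W : Set V) ∩ avoidAll ends a₂ {a₁} = clusterEvent ends a₃ (↑W : Set V) := by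
  rw [avoidAll_eq_compl]
  have h := cl_inter_conn_eq_empty ends a₃ (↑W : Set V) (u := a₁) (w := a₂) (by simpa using h1) (by simpa using h2)
  ext ω
  constructor
  · exact fun hω => hω.1
  · intro hω
    refine ⟨hω, fun hc => ?_⟩
    have : ω ∈ clusterEvent ends a₃ (↑W : Set V) ∩ connEvent ends a₁ a₂ := ⟨hω, hc⟩
    rw [h] at this
    exact this

omit [Fintype E] [DecidableEq E] [Fintype V] [DecidableEq V] in
/-- On a T′-type cluster (`a₁ ∈ W`, `a₂ ∉ W`) the event `Q` is automatic. -/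
lemma cl_inter_Q_of_T' {W : Finset V} (h1 : a₁ ∈ W) (h2 : a₂ ∉ W) :
    clusterEvent ends a₃ (↑W : Set V) ∩ avoidAll ends a₂ {a₁} = clusterEvent ends a₃ (↑W : Set V) := by
  rw [avoidAll_eq_compl]
  have h := cl_inter_conn_eq_empty' ends a₃ (↑W : Set V) (u := a₁) (w := a₂) (by simpa using h1) (by simpa using h2)
  ext ω
  constructor
  · exact fun hω => hω.1
  · intro hω
    refine ⟨hω, fun hc => ?_⟩
    have : ω ∈ clusterEvent ends a₃ (↑W : Set V) ∩ connEvent ends a₁ a₂ := ⟨hω, hc⟩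
    rw [h] at this
    exact this

end Cases

/-- **Every summand of `X̂` is a Rao–Blackwell term**: `P(C(a₃) = W) · termW(W) = rbTerm(W)`. -/
theorem prob_cl_mul_termW (hp : IsProbVec p) (W : Finset V) :
    prob p (clusterEvent ends a₃ (↑W : Set V)) * termW p ends o a₁ a₂ b W =
      rbTerm p ends o a₁ a₂ a₃ b W := by
  unfold termW rbTerm
  by_cases h1 : a₁ ∈ W
  · by_cases h2 : a₂ ∈ W
    · simp [h1, h2]
    · simp only [h1, h2, if_true, if_false]
      have hQ := cl_inter_Q_of_T' ends a₁ a₂ a₃ h1 h2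
      have := t_case ends o a₃ b hp (x := a₂) (y := a₁) h2 h1 hQ
      simpa only [clQ] using this
  · by_cases h2 : a₂ ∈ W
    · simp only [h1, h2, if_true, if_false]
      have hQ := cl_inter_Q_of_T ends a₁ a₂ a₃ h1 h2
      have := t_case ends o a₃ b hp (x := a₁) (y := a₂) h1 h2 hQ
      simpa only [clQ] using this
    · simp only [h1, h2, if_false]
      exact pd_case ends o a₁ a₂ a₃ b hp h1 h2

/-- **The mean field is a Rao–Blackwell sum**: `X̂ = Σ_W rbTerm(W)`. -/
theorem Xhat_eq_rb (hp : IsProbVec p) :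
    Xhat p ends o a₁ a₂ a₃ b = ∑ W : Finset V, rbTerm p ends o a₁ a₂ a₃ b W := by
  rw [Xhat_eq_sum]
  exact Finset.sum_congr rfl fun W _ => prob_cl_mul_termW p ends o a₁ a₂ a₃ b hp W

end XhatRB

end Summit.Ventures.PercRepro2
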